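import Summits.BirchSwinnertonDyer.Rank1Residual.ManinAdditive.RamifiedTwistOptimalityCommutesProof
import Summits.BirchSwinnertonDyer.Rank1Residual.ManinAdditive.TwistOrbitScalingEngineJumps
import Summits.BirchSwinnertonDyer.Rank1Residual.ManinAdditive.CommutingOrbitDiscrDirection
import Literature.NumberTheory.EllipticCurves.SzpiroMinimalityProofs
import Literature.NumberTheory.EllipticCurves.NeronLocalHeightCompletion
import Literature.NumberTheory.EllipticCurves.ModularCurveManinSemistableCoprimeFormProofs
import Literature.NumberTheory.EllipticCurves.QuadraticTwistJInvariantProofs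
import Literature.NumberTheory.EllipticCurves.QuadraticTwistPadicReduction
import HarnessLib
import HarnessLib.Audit.Tags

/-!
# §27 MANIN NEAR-INVARIANCE along commuting optimal ramified twists, UNCONDITIONAL (E-an-32
# `CommutingOrbitManinValNear` + `_holds`; E-an-33 edge `commutingOrbitManinValEq_iff_discrDirection`)
# — cell `bsd-f2-manin`

Cell `bsd-f2-manin` (D-0131 (3) frontier: the Manin constant at additive primes), analytic lens (planner
`bsd-f2-manin-an` g5), typed VERBATIM by the cell typer from HOME `run/shared/lean/pub/bsd-f2-manin/an/Sec24Core-g5b.lean` sha16 a6e0e51924ef88c2 (= Sec24Core-g5 9ed34f9b51be5933 + §27, lines 1183–1477 `section NearInvariance`; farm rc 0 · 0 errors · 0 warnings · 0 sorries; MEMO-an §44; CANDIDATES rows E-an-32/33); the OPEN law E-an-33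
`CommutingOrbitDiscrDirection p` is declared in its own conjecture-only leaf `CommutingOrbitDiscrDirection.lean`
(typer invariant), everything else is here. CONTENT: minimality of both equations gives
`|v_pΔ_min(W′) − v_pΔ_min(W)| ≤ 6` along `W′ ≅ W ⊗ p*` (the integral model `(0, e b₂, 0, 8e²b₄, 16e³b₆)` of
`W ⊗ 4e`, Silverman *AEC* VII.1, tree `valuation_Δ_smul_le_of_isMinimalAt`); feeding this into the valuation
form of the §24 trichotomy (`TwistOrbitIndexEngineOdd`) and the landed degree jump
(`TwistOrbitScalingEngineJumps.pStar_optimal_not_commuting_of_modularDegree_eq`) yields on every COMMUTING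
optimal `p*`-pair (`p` odd prime, `p² ∣ N = N′`): `|v_p c′ − v_p c| ≤ 1`, `v_pΔ_min′ = v_pΔ_min ± 6` EXACTLY, and
`v_p c′ = v_p c ⟺` degree and discriminant move together (`pStar_optimal_commuting_manin_near_invariance`);
with §26 the same bound for EVERY optimal pair with `W[p]` irreducible. PLACEMENT (declared by -an, refuter-2
v7 concurs): = Edixhoven 1991 §4 case analysis (`v_p(deg φ̃) = v_p(deg φ) + 1 + 2v_p(c̃/c)`; case 2 ⇒
`v_p c̃ = v_p c`; case 1 ⇒ `v_p c = 1, v_p c̃ = 0`), printed for `p > 7` under the ASSUMED proportionality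
`Λ̃ ∝ Λ` — here a kernel theorem at EVERY odd `p` exactly on the commuting locus (grade VARIANT/FORMALISATION).
Nothing conjectural is asserted: `CommutingOrbitManinValNear` comes with its `_holds`; the open laws enter
only as hypotheses / sides of a proved equivalence. After refuter-1 §R31 (the unguarded schema
`CommutingOrbitDiscrDirection` is false at `p = 1`) the leaf of record is the guarded
`CommutingOrbitDiscrDirectionR`; `commutingOrbitDiscrDirectionR_iff` and
`commutingOrbitManinValEq_iff_discrDirectionR` (appended) carry the equivalence over.
[cite: EdixhovenManin1991, §4 (pp. 12–13)]
-/

noncomputable section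

open scoped MatrixGroups ModularForm

open CongruenceSubgroup WeierstrassCurve
  Literature.NumberTheory.DiophantineGeometry
  Literature.NumberTheory.EllipticCurves
  Literature.NumberTheory.EllipticCurves.ModularForms

namespace Summit.BirchSwinnertonDyer.Rank1Residual.ManinAdditive

section NearInvariance

/-! ## §27 (g5) MANIN NEAR-INVARIANCE along commuting optimal ramified twists (unconditional)

Minimality of both equations gives `|v_pΔ_min(W′) − v_pΔ_min(W)| ≤ 6` along `W′ ≅ W ⊗ p*` (the integral model
`(0, e b₂, 0, 8e²b₄, 16e³b₆)` of `W ⊗ 4e`, Silverman *AEC* VII.1); feeding this into the valuation form of the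
§24 trichotomy and the landed degree jump (`TwistOrbitScalingEngineJumps`) yields `|v_p c′ − v_p c| ≤ 1` on every
commuting optimal `p*`-pair, with equality of valuations iff degree and discriminant move together. -/

/-- The integral twisted equation `(0, e·b₂, 0, 8e²·b₄, 16e³·b₆)` of an integral equation `M`
(the tree's model of `W ⊗ 4e`, cf. `isIntegralAt_quadraticTwist_four_mul`). -/
def twistIntModel (M : WeierstrassCurve ℤ) (e : ℤ) : WeierstrassCurve ℤ :=
  ⟨0, e * M.b₂, 0, 8 * e ^ 2 * M.b₄, 16 * e ^ 3 * M.b₆⟩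

/-- `twistIntModel (integralModelInt W) e` is a `ℤ`-model of `W ⊗ 4e`. -/
theorem baseChange_twistIntModel (W : WeierstrassCurve ℚ) [W.IsGloballyMinimal] (e : ℤ) :
    (twistIntModel (integralModelInt W) e).baseChange ℚ = W.quadraticTwist (4 * (e : ℚ)) := by
  set M : WeierstrassCurve ℤ := integralModelInt W with hM
  have hWM : M.map (Int.castRingHom ℚ) = W := map_integralModelInt W
  have hb₂ : W.b₂ = (M.b₂ : ℚ) := by rw [← hWM, map_b₂, eq_intCast]
  have hb₄ : W.b₄ = (M.b₄ : ℚ) := by rw [← hWM, map_b₄, eq_intCast]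
  have hb₆ : W.b₆ = (M.b₆ : ℚ) := by rw [← hWM, map_b₆, eq_intCast]
  ext
  · simp [twistIntModel, WeierstrassCurve.baseChange, quadraticTwist_a₁]
  · simp only [twistIntModel, WeierstrassCurve.baseChange, map_a₂, quadraticTwist_a₂, hb₂,
      algebraMap_int_eq, eq_intCast]
    push_cast; ring
  · simp [twistIntModel, WeierstrassCurve.baseChange, quadraticTwist_a₃]
  · simp only [twistIntModel, WeierstrassCurve.baseChange, map_a₄, quadraticTwist_a₄, hb₄,
      algebraMap_int_eq, eq_intCast]
    push_cast; ring
  · simp only [twistIntModel, WeierstrassCurve.baseChange, map_a₆, quadraticTwist_a₆, hb₆,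
      algebraMap_int_eq, eq_intCast]
    push_cast; ring

/-- **Minimal discriminants along a quadratic twist.** If `W′ ≅ W ⊗ e` over `ℚ` (`e ∈ ℤ ∖ {0}`), both
equations globally minimal, then for every prime `p`:
`v_p(Δ_min W′) ≤ v_p(Δ_min W) + 6·v_p(4e)` — the integral model `(0, e b₂, 0, 8e² b₄, 16e³ b₆)` of
`W ⊗ 4e ≅ W′` has discriminant `(4e)⁶ Δ_min(W)`, and a minimal equation minimises `v_p(Δ)` among
integral ones (Silverman *AEC* VII.1, X.5 Cor. 5.4). -/
theorem padicValInt_minimalDiscriminantInt_le_of_smul_quadraticTwist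
    {W W' : WeierstrassCurve ℚ} [W.IsElliptic] [W.IsGloballyMinimal] [W'.IsElliptic]
    [W'.IsGloballyMinimal] {e : ℤ} (he : e ≠ 0) (C : VariableChange ℚ)
    (hC : C • W.quadraticTwist (e : ℚ) = W') (p : ℕ) [hp : Fact p.Prime] :
    padicValInt p W'.minimalDiscriminantInt ≤
      padicValInt p W.minimalDiscriminantInt + 6 * padicValInt p (4 * e) := by
  set v : IsDedekindDomain.HeightOneSpectrum ℤ :=
    (Rat.HeightOneSpectrum.primesEquiv (R := ℤ)).symm ⟨p, hp.out⟩ with hvdef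
  have hv : Rat.HeightOneSpectrum.natGenerator v = p :=
    congrArg Subtype.val ((Rat.HeightOneSpectrum.primesEquiv (R := ℤ)).apply_symm_apply ⟨p, hp.out⟩)
  set X : WeierstrassCurve ℤ := twistIntModel (integralModelInt W) e with hXdef
  have hX : X.baseChange ℚ = W.quadraticTwist (4 * (e : ℚ)) := baseChange_twistIntModel W e
  obtain ⟨C₂, hC₂⟩ := W.exists_variableChange_quadraticTwist_mul_sq (e : ℚ) 2 two_ne_zero
  have h4e : W.quadraticTwist ((e : ℚ) * 2 ^ 2) = W.quadraticTwist (4 * (e : ℚ)) := by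
    congr 1; ring
  have hC₃ : (C₂ * C⁻¹) • W' = X.baseChange ℚ := by
    rw [hX, ← h4e, ← hC₂, ← hC, mul_smul, inv_smul_smul]
  have hmin : W'.IsMinimalAt v := IsGloballyMinimal.isMinimalAt_int W' v
  have hint : ((C₂ * C⁻¹) • W').IsIntegralAt v := by
    rw [hC₃]; exact isIntegralAt_baseChange_int v X
  have hle := valuation_Δ_smul_le_of_isMinimalAt v hmin (C₂ * C⁻¹) hint
  rw [hC₃, hX, quadraticTwist_Δ, ← cast_minimalDiscriminantInt W, ← cast_minimalDiscriminantInt W']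
    at hle
  have hΔ0 : W.minimalDiscriminantInt ≠ 0 := W.minimalDiscriminantInt_ne_zero
  have hΔ0' : W'.minimalDiscriminantInt ≠ 0 := W'.minimalDiscriminantInt_ne_zero
  have h4e0 : (4 * e : ℤ) ≠ 0 := mul_ne_zero (by norm_num) he
  have hcast : (4 * (e : ℚ)) ^ 6 * (W.minimalDiscriminantInt : ℚ) =
      (((4 * e) ^ 6 * W.minimalDiscriminantInt : ℤ) : ℚ) := by push_cast; ring
  have hne1 : (((4 * e) ^ 6 * W.minimalDiscriminantInt : ℤ) : ℚ) ≠ 0 := by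
    exact_mod_cast mul_ne_zero (pow_ne_zero _ h4e0) hΔ0
  have hne2 : (W'.minimalDiscriminantInt : ℚ) ≠ 0 := by exact_mod_cast hΔ0'
  rw [hcast, Rat.HeightOneSpectrum.valuation_eq_exp_neg_padicValRat v hne1,
    Rat.HeightOneSpectrum.valuation_eq_exp_neg_padicValRat v hne2, hv, WithZero.exp_le_exp,
    neg_le_neg_iff, padicValRat.of_int, padicValRat.of_int, Nat.cast_le] at hle
  rw [padicValInt.mul (pow_ne_zero _ h4e0) hΔ0, padicValInt_pow'] at hle
  omega

/-- The reverse isomorphism along a twist orbit: `u • (W ⊗ d) = W′` gives `C • (W′ ⊗ d) = W`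
(`(W ⊗ d) ⊗ d = W ⊗ d² ≅ W`, and twisting commutes with changes of variables). -/
theorem exists_smul_quadraticTwist_eq_of_smul_quadraticTwist_eq {W W' : WeierstrassCurve ℚ}
    {d : ℚ} (hd : d ≠ 0) (u : VariableChange ℚ) (hu : u • W.quadraticTwist d = W') :
    ∃ C : VariableChange ℚ, C • W'.quadraticTwist d = W := by
  obtain ⟨C₁, hC₁⟩ := exists_variableChange_smul_eq_quadraticTwist_sq W hd
  -- hC₁ : C₁ • W = W.quadraticTwist (d ^ 2)
  have h1 : W'.quadraticTwist d =
      (⟨u.u, d * u.r, 0, 0⟩ : VariableChange ℚ) • (W.quadraticTwist d).quadraticTwist d := by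
    rw [← hu, quadraticTwist_smul]
  rw [quadraticTwist_quadraticTwist, ← sq, ← hC₁, smul_smul] at h1
  refine ⟨((⟨u.u, d * u.r, 0, 0⟩ : VariableChange ℚ) * C₁)⁻¹, ?_⟩
  rw [h1, inv_smul_smul]

/-- **`|v_p(Δ_min W′) − v_p(Δ_min W)| ≤ 6` along an odd ramified twist**: for `u • (W ⊗ p*) = W′`,
both globally minimal, `p` odd: `v_p(Δ′) ≤ v_p(Δ) + 6` and `v_p(Δ) ≤ v_p(Δ′) + 6`. -/
theorem padicValInt_minimalDiscriminantInt_pStar_twist_le {p : ℕ} [hp : Fact p.Prime] (hp2 : p ≠ 2)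
    {W W' : WeierstrassCurve ℚ} [W.IsElliptic] [W.IsGloballyMinimal] [W'.IsElliptic]
    [W'.IsGloballyMinimal] (u : VariableChange ℚ)
    (hu : u • W.quadraticTwist ((((-1 : ℤ) ^ (p / 2) * p : ℤ)) : ℚ) = W') :
    padicValInt p W'.minimalDiscriminantInt ≤ padicValInt p W.minimalDiscriminantInt + 6 ∧
    padicValInt p W.minimalDiscriminantInt ≤ padicValInt p W'.minimalDiscriminantInt + 6 := by
  have hpr : p.Prime := hp.out
  set d : ℤ := (-1 : ℤ) ^ (p / 2) * p with hd
  have hdZ : d ≠ 0 := mul_ne_zero (pow_ne_zero _ (by norm_num)) (by exact_mod_cast hpr.ne_zero)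
  have hd0 : (d : ℚ) ≠ 0 := by exact_mod_cast hdZ
  have hv4d : padicValInt p (4 * d) = 1 := by
    have h4 : ¬ (p : ℤ) ∣ 4 := by
      intro h
      have h' : (p : ℤ) ∣ (2 : ℤ) ^ 2 := by norm_num; exact h
      have h2 : (p : ℤ) ∣ 2 := (Nat.prime_iff_prime_int.mp hpr).dvd_of_dvd_pow h'
      have := Int.le_of_dvd (by norm_num) h2
      have h2le : p ≤ 2 := by exact_mod_cast this
      exact hp2 (le_antisymm h2le hpr.two_le)
    rw [padicValInt.mul (by norm_num) hdZ, padicValInt.eq_zero_of_not_dvd h4, zero_add, hd,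
      padicValInt.mul (pow_ne_zero _ (by norm_num)) (by exact_mod_cast hpr.ne_zero),
      padicValInt_pow', padicValInt_self]
    simp [padicValInt]
  obtain ⟨C, hC⟩ := exists_smul_quadraticTwist_eq_of_smul_quadraticTwist_eq hd0 u hu
  constructor
  · have h := padicValInt_minimalDiscriminantInt_le_of_smul_quadraticTwist hdZ u hu p
    rw [hv4d] at h; omega
  · have h := padicValInt_minimalDiscriminantInt_le_of_smul_quadraticTwist hdZ C hC p
    rw [hv4d] at h; omega


/-- **§27 MAIN THEOREM — MANIN NEAR-INVARIANCE ALONG A COMMUTING OPTIMAL `p*`-ORBIT (unconditional).**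
`p` odd prime, `W`, `W′` globally minimal, `D`, `D′` lattice-optimal data at the conductors `N′ = N`, `p² ∣ N`,
`u • (W ⊗ p*) = W′`.  Then EITHER the degree goes up by `p` and
`(v_p c′, v_pΔ′) ∈ {(v_p c, v_pΔ + 6), (v_p c + 1, v_pΔ − 6)}`, OR the degree goes down by `p` and symmetrically.
In particular `|v_p(c′) − v_p(c)| ≤ 1` ALWAYS, and `v_p(c′) = v_p(c)` iff the minimal discriminant moves in the
SAME direction as the modular degree.  (Trichotomy valuation form §24 + `|v_pΔ′ − v_pΔ| ≤ 6` from minimality +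
the landed degree jump `pStar_optimal_commuting_degree_jump`, which excludes `deg′ = deg` on commuting pairs.)
PLACEMENT: this is Edixhoven's §4 case analysis — `v_p(deg φ̃) = v_p(deg φ) + 1 + 2·v_p(c̃/c)`, «case 2: `v_p(c̃) =
v_p(c)`; case 1: `v_p(c) = 1`, `v_p(c̃) = 0`», there for `p > 7`, under the ASSUMED proportionality `Λ̃ ∝ Λ` and via the
classification of cyclic isogenies — made a kernel theorem at EVERY odd `p` on exactly the locus where proportionality
holds (commuting pairs), with global minimality (`|v_pΔ′ − v_pΔ| ≤ 6`) in place of «replace `E` by `Ẽ` to get type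
II/III/IV» and NO isogeny classification. [cite: EdixhovenManin1991, §4 (pp. 12–13)] -/
theorem pStar_optimal_commuting_manin_near_invariance {p : ℕ} (hp : p.Prime) (hp2 : p ≠ 2) :
    ∀ (W W' : WeierstrassCurve ℚ) [W.IsElliptic] [W.IsGloballyMinimal] [W'.IsElliptic]
      [W'.IsGloballyMinimal] [NeZero (W.conductorNorm ℤ)] [NeZero (W'.conductorNorm ℤ)]
      (u : VariableChange ℚ) (D : ModularParametrizationData W (W.conductorNorm ℤ))
      (D' : ModularParametrizationData W' (W'.conductorNorm ℤ)),
      IsLatticeOptimal D → IsLatticeOptimal D' →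
      p ^ 2 ∣ W.conductorNorm ℤ → W'.conductorNorm ℤ = W.conductorNorm ℤ →
      u • W.quadraticTwist ((((-1 : ℤ) ^ (p / 2) * p : ℤ)) : ℚ) = W' →
      (D'.modularDegree = p * D.modularDegree ∧
        (padicValInt p D'.c = padicValInt p D.c ∧
            padicValInt p W'.minimalDiscriminantInt = padicValInt p W.minimalDiscriminantInt + 6 ∨
          padicValInt p D'.c = padicValInt p D.c + 1 ∧
            padicValInt p W'.minimalDiscriminantInt + 6 = padicValInt p W.minimalDiscriminantInt)) ∨
      (p * D'.modularDegree = D.modularDegree ∧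
        (padicValInt p D'.c = padicValInt p D.c ∧
            padicValInt p W.minimalDiscriminantInt = padicValInt p W'.minimalDiscriminantInt + 6 ∨
          padicValInt p D'.c + 1 = padicValInt p D.c ∧
            padicValInt p W.minimalDiscriminantInt + 6 = padicValInt p W'.minimalDiscriminantInt)) := by
  intro W W' _ _ _ _ _ _ u D D' hD hD' hM hN hu
  haveI : Fact p.Prime := ⟨hp⟩
  obtain ⟨hle1, hle2⟩ := padicValInt_minimalDiscriminantInt_pStar_twist_le hp2 u hu
  have hiso := isIsogenous_of_smul_eq hu
  rcases pStar_optimal_orbit_trichotomy_val hp hp2 W W' D D' hD hD' hM hN hiso with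
    ⟨hdeg, hv⟩ | ⟨hdeg, hv⟩ | hdeg
  · left
    refine ⟨hdeg, ?_⟩
    omega
  · right
    refine ⟨hdeg, ?_⟩
    omega
  · exact absurd hu (pStar_optimal_not_commuting_of_modularDegree_eq hp hp2 D D' hM hN hD hD' hdeg u)

/-- **COROLLARY: `|v_p(c′) − v_p(c)| ≤ 1` on every commuting optimal `p*`-pair** (unconditional). -/
theorem pStar_optimal_commuting_padicValInt_c_near {p : ℕ} (hp : p.Prime) (hp2 : p ≠ 2) :
    ∀ (W W' : WeierstrassCurve ℚ) [W.IsElliptic] [W.IsGloballyMinimal] [W'.IsElliptic]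
      [W'.IsGloballyMinimal] [NeZero (W.conductorNorm ℤ)] [NeZero (W'.conductorNorm ℤ)]
      (u : VariableChange ℚ) (D : ModularParametrizationData W (W.conductorNorm ℤ))
      (D' : ModularParametrizationData W' (W'.conductorNorm ℤ)),
      IsLatticeOptimal D → IsLatticeOptimal D' →
      p ^ 2 ∣ W.conductorNorm ℤ → W'.conductorNorm ℤ = W.conductorNorm ℤ →
      u • W.quadraticTwist ((((-1 : ℤ) ^ (p / 2) * p : ℤ)) : ℚ) = W' →
      padicValInt p D'.c ≤ padicValInt p D.c + 1 ∧ padicValInt p D.c ≤ padicValInt p D'.c + 1 := by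
  intro W W' _ _ _ _ _ _ u D D' hD hD' hM hN hu
  rcases pStar_optimal_commuting_manin_near_invariance hp hp2 W W' u D D' hD hD' hM hN hu with
    ⟨-, h⟩ | ⟨-, h⟩ <;> omega

/-- **COROLLARY: the minimal discriminant jumps by EXACTLY `6` at `p` along a commuting optimal `p*`-pair**
(`v_pΔ′ = v_pΔ ± 6`; census: Δv_pΔ = ±6 on 667 706/667 706 commuting odd-`p` same-N rows). -/
theorem pStar_optimal_commuting_padicValInt_Δ_jump {p : ℕ} (hp : p.Prime) (hp2 : p ≠ 2) :
    ∀ (W W' : WeierstrassCurve ℚ) [W.IsElliptic] [W.IsGloballyMinimal] [W'.IsElliptic]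
      [W'.IsGloballyMinimal] [NeZero (W.conductorNorm ℤ)] [NeZero (W'.conductorNorm ℤ)]
      (u : VariableChange ℚ) (D : ModularParametrizationData W (W.conductorNorm ℤ))
      (D' : ModularParametrizationData W' (W'.conductorNorm ℤ)),
      IsLatticeOptimal D → IsLatticeOptimal D' →
      p ^ 2 ∣ W.conductorNorm ℤ → W'.conductorNorm ℤ = W.conductorNorm ℤ →
      u • W.quadraticTwist ((((-1 : ℤ) ^ (p / 2) * p : ℤ)) : ℚ) = W' →
      padicValInt p W'.minimalDiscriminantInt = padicValInt p W.minimalDiscriminantInt + 6 ∨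
        padicValInt p W.minimalDiscriminantInt = padicValInt p W'.minimalDiscriminantInt + 6 := by
  intro W W' _ _ _ _ _ _ u D D' hD hD' hM hN hu
  rcases pStar_optimal_commuting_manin_near_invariance hp hp2 W W' u D D' hD hD' hM hN hu with
    ⟨-, h⟩ | ⟨-, h⟩ <;> omega

/-- **COROLLARY (with §26): on the IRREDUCIBLE locus `|v_p(c′) − v_p(c)| ≤ 1` for EVERY optimal `p*`-pair**
(E-imc-3b proved ⇒ the pair commutes). -/
theorem pStar_optimal_padicValInt_c_near_of_irreducible {p : ℕ} (hp : p.Prime) (hp2 : p ≠ 2) :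
    ∀ (W W' : WeierstrassCurve ℚ) [W.IsElliptic] [W.IsGloballyMinimal] [W'.IsElliptic]
      [W'.IsGloballyMinimal] [NeZero (W.conductorNorm ℤ)] [NeZero (W'.conductorNorm ℤ)]
      (D : ModularParametrizationData W (W.conductorNorm ℤ))
      (D' : ModularParametrizationData W' (W'.conductorNorm ℤ)),
      IsLatticeOptimal D → IsLatticeOptimal D' →
      p ^ 2 ∣ W.conductorNorm ℤ → W'.conductorNorm ℤ = W.conductorNorm ℤ →
      IsIsogenous (W.quadraticTwist ((((-1 : ℤ) ^ (p / 2) * p : ℤ)) : ℚ)) W' →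
      W.HasIrreducibleModPGaloisRep p →
      padicValInt p D'.c ≤ padicValInt p D.c + 1 ∧ padicValInt p D.c ≤ padicValInt p D'.c + 1 := by
  intro W W' _ _ _ _ _ _ D D' hD hD' hM hN hiso hirr
  obtain ⟨u, hu⟩ := pStar_optimal_orbit_commutes_of_irreducible hp hp2 W W' D D' hD hD' hM hN hiso hirr
  exact pStar_optimal_commuting_padicValInt_c_near hp hp2 W W' u D D' hD hD' hM hN hu

/-- **TYPED LEAF E-an-32 (hypothesis-free, PROVED below): MANIN NEAR-INVARIANCE along commuting optimal
ramified twists at an odd additive prime** — imc's E-imc-1b up to ONE power of `p`. Binder grammar of the imc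
leaves. (A THEOREM; its data shadow: `v_pΔ′ − v_pΔ = ±6` EXACTLY on commuting pairs —
`pStar_optimal_commuting_padicValInt_Δ_jump` — holds on 667 706/667 706 commuting odd-`p` same-conductor rows of
TWISTCENSUS2 v1, HOME/an/direction-test-g5.txt.) -/
@[conjecture] def CommutingOrbitManinValNear (p : ℕ) : Prop :=
  p.Prime → p ≠ 2 →
  ∀ (W W' : WeierstrassCurve ℚ) [W.IsElliptic] [W.IsGloballyMinimal] [W'.IsElliptic]
    [W'.IsGloballyMinimal] [NeZero (W.conductorNorm ℤ)] [NeZero (W'.conductorNorm ℤ)]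
    (u : VariableChange ℚ) (D : ModularParametrizationData W (W.conductorNorm ℤ))
    (D' : ModularParametrizationData W' (W'.conductorNorm ℤ)),
    (∀ z ∈ D.L.lattice, ∃ w ∈ periodLattice D.f, z = D.c * w) →
    (∀ z ∈ D'.L.lattice, ∃ w ∈ periodLattice D'.f, z = D'.c * w) →
    p ^ 2 ∣ W.conductorNorm ℤ → W'.conductorNorm ℤ = W.conductorNorm ℤ →
    u • W.quadraticTwist ((((-1 : ℤ) ^ (p / 2) * p : ℤ)) : ℚ) = W' →
    padicValInt p D'.c ≤ padicValInt p D.c + 1 ∧ padicValInt p D.c ≤ padicValInt p D'.c + 1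

/-- E-an-32 PROVED. -/
theorem commutingOrbitManinValNear_holds (p : ℕ) : CommutingOrbitManinValNear p := by
  intro hp hp2 W W' _ _ _ _ _ _ u D D' hD hD' hM hN hu
  exact pStar_optimal_commuting_padicValInt_c_near hp hp2 W W' u D D' hD hD' hM hN hu

/-- **E-imc-1b on commuting pairs ⟺ the discriminant direction law** (odd `p`; PROVED). -/
theorem commutingOrbitManinValEq_iff_discrDirection {p : ℕ} (hp : p.Prime) (hp2 : p ≠ 2) :
    CommutingOrbitManinValEq p ↔ CommutingOrbitDiscrDirection p := by
  constructor
  · intro hV W W' _ _ _ _ _ _ u D D' hD hD' hM hN hu hdeg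
    have hc := hV W W' u D D' hD hD' hM hN hu
    rcases pStar_optimal_commuting_manin_near_invariance hp hp2 W W' u D D' hD hD' hM hN hu with
      ⟨-, h⟩ | ⟨hdeg', -⟩
    · omega
    · exfalso
      have hpos : 0 < D.modularDegree := D.deg_pos
      have h1 : p * (p * D.modularDegree) = 1 * D.modularDegree := by rw [← hdeg, hdeg', one_mul]
      have h2 : p * p = 1 := Nat.eq_of_mul_eq_mul_right hpos (by rw [← mul_assoc] at h1; exact h1)
      exact hp.one_lt.ne' (Nat.eq_one_of_mul_eq_one_right h2)
  · intro hΔ W W' _ _ _ _ _ _ u D D' hD hD' hM hN hu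
    rcases pStar_optimal_commuting_manin_near_invariance hp hp2 W W' u D D' hD hD' hM hN hu with
      ⟨hdeg, h⟩ | ⟨hdeg, h⟩
    · have := hΔ W W' u D D' hD hD' hM hN hu hdeg
      omega
    · -- symmetric: apply the direction law to the reversed pair (W′, W)
      have hpr : p.Prime := hp
      have hdZ : ((-1 : ℤ) ^ (p / 2) * p : ℤ) ≠ 0 :=
        mul_ne_zero (pow_ne_zero _ (by norm_num)) (by exact_mod_cast hpr.ne_zero)
      have hd0 : ((((-1 : ℤ) ^ (p / 2) * p : ℤ)) : ℚ) ≠ 0 := by exact_mod_cast hdZ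
      obtain ⟨C, hC⟩ := exists_smul_quadraticTwist_eq_of_smul_quadraticTwist_eq hd0 u hu
      have hM' : p ^ 2 ∣ W'.conductorNorm ℤ := by rw [hN]; exact hM
      have := hΔ W' W C D' D hD' hD hM' hN.symm hC (by rw [hdeg])
      omega

/-- The repaired leaf E-an-33 C′ (`CommutingOrbitDiscrDirectionR`, guarded by `p.Prime → p ≠ 2 →`,
refuter-1 §R31) is, at an odd prime `p`, the superseded unguarded schema. [folklore] -/
theorem commutingOrbitDiscrDirectionR_iff {p : ℕ} (hp : p.Prime) (hp2 : p ≠ 2) :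
    CommutingOrbitDiscrDirectionR p ↔ CommutingOrbitDiscrDirection p :=
  ⟨fun h ↦ h hp hp2, fun h _ _ ↦ h⟩

/-- **E-imc-1b on commuting pairs ⟺ the discriminant direction law, REPAIRED FORM C′** (odd prime `p`;
PROVED): `CommutingOrbitManinValEq p ↔ CommutingOrbitDiscrDirectionR p` — the edge of record after
refuter-1 §R31 (the unguarded `CommutingOrbitDiscrDirection 1` is false; the guarded form is the typed
open node). [cite: EdixhovenManin1991, §4 (pp. 12–13)] -/
theorem commutingOrbitManinValEq_iff_discrDirectionR {p : ℕ} (hp : p.Prime) (hp2 : p ≠ 2) :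
    CommutingOrbitManinValEq p ↔ CommutingOrbitDiscrDirectionR p :=
  (commutingOrbitManinValEq_iff_discrDirection hp hp2).trans (commutingOrbitDiscrDirectionR_iff hp hp2).symm

end NearInvariance

end Summit.BirchSwinnertonDyer.Rank1Residual.ManinAdditive

end
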